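import Summits.MatrixMultiplication.MatrixMultiplication.Theorems.AbelianSTPPCensusThreeRoomEnergyPlus

/-!
# E3⁺ on shape data: the predicate `E3pAdm`, its soundness for STPP families, and its heredity (cell mm-stpp, eng-2 g5)

The cell's registered successor shape instrument is vQ := vP ∧ E3⁺ (HOME/CENSUS-PLAN §6.1 (ae), 2026-08-27): the shape sieve vP
(`SieveAdmissibleVP`) plus the refined three-room energy rule E3⁺ of `STPPThreeRoomEnergy.three_room_energy_plus` (p491649; kill schema
`false_of_energy3p`).  Until now E3⁺ existed in the kernel only as a per-instance kill schema («two codes, not kernel» for every vQ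
statement of the memo; the weaker E3 has the shape form `TAKnap575.E3Adm`).  This file is the SHAPE-LEVEL INTERFACE of E3⁺:

* `e3pLHS M x y z S_A S_B S_C` — the left-hand side of E3⁺ for ONE member with sizes `(x, y, z)`, `V = xyz`, at order `M`, given the
  three off-member packing sums `S_A = Σ_{u≠t} b_u c_u`, `S_B = Σ_{u≠t} c_u a_u`, `S_C = Σ_{u≠t} a_u b_u` — LITERALLY the hypothesis
  shape `hkill` of `false_of_energy3p` (truncated subtraction throughout: slacks `s_X = M − (V + S_X)`, `θ = V − (s_A + s_B + s_C)`,
  `LHS = M·θ + (V − θ) + (x−1)((V − s_A) − θ) + (y−1)((V − s_B) − θ) + (z−1)((V − s_C) − θ)`);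
* `E3pAdm M a b c` — **E3⁺ on a shape list**: every member `t` with `2·V_t > M` has `e3pLHS ≤ V_t²`;
* `e3pAdm_of_isSTPP` — **soundness**: the shape data of every `IsSTPP` family with non-empty sets in a finite abelian group of order
  `M` satisfies `E3pAdm M` (= `three_room_energy_plus`, member by member);
* `e3pAdm_of_small` — E3⁺ is SILENT BELOW DOUBLING (vacuous when every `2V_t ≤ M`; cf. `AbelianSTPPCensusVP.silent_censusTE_false_above_8192`);
* `e3pL_anti` / `e3pLHS_mono` — **monotonicity**: `e3pLHS` is non-decreasing in each off-member sum `S_X` (equivalently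
  non-increasing in each slack) as soon as `V ≤ M` and `x, y, z ≥ 1` — one more member can only LOWER the three room caps, so a
  member killed by E3⁺ inside a sub-family stays killed in every super-family;
* `E3pAdm.restrict` — **heredity**: `E3pAdm M a b c → E3pAdm M (a ∘ f) (b ∘ f) (c ∘ f)` along any injection `f` (positive sizes,
  volumes `≤ M`) — the one lemma a prefix-pruning kernel certificate for vQ needs (HOME/mm-stpp-eng-2/energy3/VQ-CERT-SPEC.md item 1:
  the DFS kills PREFIXES, soundness needs «killed prefix ⇒ every completion killed»).

Arithmetic of the monotonicity (pencil, = the proof of `e3pL_anti`): write `σ = s_A + s_B + s_C`.  If `σ ≤ V` nothing truncates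
and `LHS = M(V − σ) + σ + (x−1)(s_B + s_C) + (y−1)(s_A + s_C) + (z−1)(s_A + s_B)`, so raising `s_A` by `Δ` changes `LHS` by
`Δ·(−M + 1 + (y−1) + (z−1)) ≤ 0` because `y + z − 1 ≤ yz ≤ xyz = V ≤ M`; if `σ ≥ V` then `θ = 0` and
`LHS = V + (x−1)(V − s_A) + (y−1)(V − s_B) + (z−1)(V − s_C)` is visibly antitone; across the threshold the same two estimates combine.

WHAT THIS IS NOT: no new rule (E3⁺ is p491649's), no census number, no `ω` statement, no existence claim; a predicate plus its
soundness/heredity lemmas, consumed by vQ-level statements (`AbelianSTPPCensusVQ…`) and by any future `checkVQ` certificate.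
-/

-- single-conjunct summit: the mandated namespace repeats `MatrixMultiplication`.
set_option linter.dupNamespace false
set_option autoImplicit false

namespace Summit.MatrixMultiplication.MatrixMultiplication.Theorems

namespace STPPThreeRoomEnergy

open Finset Literature.Computability.AlgebraicComplexity

/-! ## The E3⁺ left-hand side of one member -/

/-- The E3⁺ left-hand side in SLACK variables: order `M`, volume `V`, sizes `x, y, z`, slacks `sA, sB, sC`
(`θ = V − (sA+sB+sC)`, all subtractions truncated):
`M·θ + (V − θ) + (x−1)((V − sA) − θ) + (y−1)((V − sB) − θ) + (z−1)((V − sC) − θ)`.  Checker-internal normal form of `e3pLHS`;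
no claim. [original] -/
def e3pL (M V x y z sA sB sC : ℕ) : ℕ :=
  M * (V - (sA + sB + sC)) + (V - (V - (sA + sB + sC))) +
    (x - 1) * ((V - sA) - (V - (sA + sB + sC))) +
    (y - 1) * ((V - sB) - (V - (sA + sB + sC))) +
    (z - 1) * ((V - sC) - (V - (sA + sB + sC)))

/-- **The E3⁺ left-hand side of one member on shape data**: sizes `(x, y, z)` (`V = xyz`), order `M`, off-member packing sums
`S_A = Σ_{u≠t} b_u c_u`, `S_B = Σ_{u≠t} c_u a_u`, `S_C = Σ_{u≠t} a_u b_u`; the slacks are `s_X = M − (V + S_X)` (truncated).  This is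
literally the right-hand side of hypothesis `hkill` of `STPPThreeRoomEnergy.false_of_energy3p` (p491649). [original] -/
def e3pLHS (M x y z SA SB SC : ℕ) : ℕ :=
  e3pL M (x * y * z) x y z (M - (x * y * z + SA)) (M - (x * y * z + SB)) (M - (x * y * z + SC))

/-- **E3⁺ on shape data (the shape-level form of the registered rule E3⁺ of vQ := vP ∧ E3⁺).**  For a shape list
`(a_i, b_i, c_i)_{i<N}` at order `M`: every member `t` with `2·V_t > M` (`V_t = a_t b_t c_t`) satisfies `e3pLHS ≤ V_t²` with the
off-member sums `S_A = Σ_{u≠t} b_u c_u`, `S_B = Σ_{u≠t} c_u a_u`, `S_C = Σ_{u≠t} a_u b_u`.  Sound for STPP families by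
`e3pAdm_of_isSTPP`; no claim by itself. [original] -/
def E3pAdm {N : ℕ} (M : ℕ) (a b c : Fin N → ℕ) : Prop :=
  ∀ t : Fin N, M < 2 * (a t * b t * c t) →
    e3pLHS M (a t) (b t) (c t) (∑ u ∈ univ.erase t, b u * c u) (∑ u ∈ univ.erase t, c u * a u)
      (∑ u ∈ univ.erase t, a u * b u) ≤ (a t * b t * c t) ^ 2

/-! ## Soundness: every STPP family satisfies E3⁺ on its shape data -/

/-- **E3⁺ holds on the shape data of every STPP family** (finite abelian host, all sets non-empty):
`E3pAdm |H| (|A_i|) (|B_i|) (|C_i|)` — member by member this is `three_room_energy_plus` (p491649) with the exact U14⁺ slacks,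
packaged through its kill schema `false_of_energy3p`. [original] -/
theorem e3pAdm_of_isSTPP {H : Type*} [AddCommGroup H] [Fintype H] [DecidableEq H] {N : ℕ} {A B C : Fin N → Finset H}
    (hS : IsSTPP A B C) (hne : ∀ i, (A i).Nonempty ∧ (B i).Nonempty ∧ (C i).Nonempty) :
    E3pAdm (Fintype.card H) (fun i => (A i).card) (fun i => (B i).card) (fun i => (C i).card) := by
  intro t h2
  by_contra hlt
  have hpos : ∀ r, 0 < (A r).card ∧ 0 < (B r).card ∧ 0 < (C r).card :=
    fun r => ⟨card_pos.2 (hne r).1, card_pos.2 (hne r).2.1, card_pos.2 (hne r).2.2⟩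
  exact false_of_energy3p hS (a := fun i => (A i).card) (b := fun i => (B i).card) (c := fun i => (C i).card)
    (fun _ => rfl) (fun _ => rfl) (fun _ => rfl) hpos rfl t _ _ _ rfl rfl rfl h2 (not_le.mp hlt)

/-- E3⁺ is SILENT BELOW DOUBLING: a list all of whose members have `2V_t ≤ M` satisfies `E3pAdm M` vacuously (so every
`AbelianSTPPCensusVP.silent_census…` ceiling applies to vQ). [bookkeeping] -/
theorem e3pAdm_of_small {N M : ℕ} {a b c : Fin N → ℕ} (h : ∀ t, 2 * (a t * b t * c t) ≤ M) : E3pAdm M a b c :=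
  fun t ht => absurd ht (not_lt.2 (h t))

/-- The E3 core is a summand of the E3⁺ left-hand side: `M·θ ≤ e3pLHS` (so E3⁺-admissible lists are E3-admissible; the shape form
`TAKnap575.E3Adm` of E3 reads `M·θ ≤ V²` with the same `θ`). [bookkeeping] -/
theorem e3core_le_e3pLHS (M x y z SA SB SC : ℕ) :
    M * (x * y * z - ((M - (x * y * z + SA)) + (M - (x * y * z + SB)) + (M - (x * y * z + SC)))) ≤
      e3pLHS M x y z SA SB SC := by
  unfold e3pLHS e3pL
  omega

/-! ## Monotonicity in the slacks / off-member sums (heredity of the kill) -/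

/-- Exact regime: if `sA + sB + sC ≤ V` no subtraction truncates and
`e3pL = M(V − σ) + σ + (x−1)(sB+sC) + (y−1)(sA+sC) + (z−1)(sA+sB)`. [bookkeeping] -/
theorem e3pL_eq_of_le {M V x y z sA sB sC : ℕ} (h : sA + sB + sC ≤ V) :
    e3pL M V x y z sA sB sC =
      M * (V - (sA + sB + sC)) + (sA + sB + sC) + (x - 1) * (sB + sC) + (y - 1) * (sA + sC) + (z - 1) * (sA + sB) := by
  unfold e3pL
  have h1 : V - (V - (sA + sB + sC)) = sA + sB + sC := by omega
  have h2 : (V - sA) - (V - (sA + sB + sC)) = sB + sC := by omega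
  have h3 : (V - sB) - (V - (sA + sB + sC)) = sA + sC := by omega
  have h4 : (V - sC) - (V - (sA + sB + sC)) = sA + sB := by omega
  rw [h1, h2, h3, h4]

/-- Saturated regime: if `V ≤ sA + sB + sC` then `θ = 0` and `e3pL = V + (x−1)(V − sA) + (y−1)(V − sB) + (z−1)(V − sC)`.
[bookkeeping] -/
theorem e3pL_eq_of_ge {M V x y z sA sB sC : ℕ} (h : V ≤ sA + sB + sC) :
    e3pL M V x y z sA sB sC = V + (x - 1) * (V - sA) + (y - 1) * (V - sB) + (z - 1) * (V - sC) := by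
  unfold e3pL
  have h0 : V - (sA + sB + sC) = 0 := by omega
  rw [h0]
  simp

/-- **`e3pL` is antitone in the slack `sA`** when `y, z ≥ 1` and `y + z ≤ M + 1` (with `V = xyz ≤ M` this holds): a larger
A-slack (fewer other members) never increases the E3⁺ left-hand side.  Three regimes: both sides exact (`σ' ≤ V`), exact → saturated,
both saturated. [original] -/
theorem e3pL_anti_A {M V x y z sA sB sC sA' : ℕ} (hy : 1 ≤ y) (hz : 1 ≤ z) (hyz : y + z ≤ M + 1) (hA : sA ≤ sA') :
    e3pL M V x y z sA' sB sC ≤ e3pL M V x y z sA sB sC := by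
  obtain ⟨y, rfl⟩ := Nat.exists_eq_add_of_le' hy
  obtain ⟨z, rfl⟩ := Nat.exists_eq_add_of_le' hz
  obtain ⟨dA, rfl⟩ := Nat.exists_eq_add_of_le hA
  have hM : 1 + y + z ≤ M := by omega
  by_cases h' : sA + dA + sB + sC ≤ V
  · -- both exact
    have h : sA + sB + sC ≤ V := by omega
    rw [e3pL_eq_of_le h', e3pL_eq_of_le h]
    simp only [Nat.add_sub_cancel]
    obtain ⟨θ', hθ'⟩ : ∃ θ', V - (sA + dA + sB + sC) = θ' := ⟨_, rfl⟩
    have hθ : V - (sA + sB + sC) = θ' + dA := by omega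
    rw [hθ', hθ]
    have key := Nat.mul_le_mul_right dA hM
    nlinarith [key, Nat.zero_le (x - 1), Nat.zero_le ((x - 1) * (sB + sC))]
  · rw [e3pL_eq_of_ge (by omega : V ≤ sA + dA + sB + sC)]
    by_cases h : sA + sB + sC ≤ V
    · -- exact → saturated
      rw [e3pL_eq_of_le h]
      simp only [Nat.add_sub_cancel]
      obtain ⟨θ, hθ⟩ : ∃ θ, V - (sA + sB + sC) = θ := ⟨_, rfl⟩
      have hV : V = θ + sA + sB + sC := by omega
      rw [hθ]
      have e1 : V - (sA + dA) ≤ sB + sC := by omega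
      have e2 : V - sB = θ + (sA + sC) := by omega
      have e3 : V - sC = θ + (sA + sB) := by omega
      rw [e2, e3]
      have key := Nat.mul_le_mul_right θ hM
      nlinarith [e1, key, Nat.zero_le (x - 1), Nat.mul_le_mul_left (x - 1) e1]
    · -- both saturated
      rw [e3pL_eq_of_ge (by omega : V ≤ sA + sB + sC)]
      have e1 : V - (sA + dA) ≤ V - sA := by omega
      gcongr

/-- `e3pL` is antitone in the slack `sB` (`x, z ≥ 1`, `x + z ≤ M + 1`). [original] -/
theorem e3pL_anti_B {M V x y z sA sB sC sB' : ℕ} (hx : 1 ≤ x) (hz : 1 ≤ z) (hxz : x + z ≤ M + 1) (hB : sB ≤ sB') :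
    e3pL M V x y z sA sB' sC ≤ e3pL M V x y z sA sB sC := by
  obtain ⟨x, rfl⟩ := Nat.exists_eq_add_of_le' hx
  obtain ⟨z, rfl⟩ := Nat.exists_eq_add_of_le' hz
  obtain ⟨dB, rfl⟩ := Nat.exists_eq_add_of_le hB
  have hM : 1 + x + z ≤ M := by omega
  by_cases h' : sA + (sB + dB) + sC ≤ V
  · have h : sA + sB + sC ≤ V := by omega
    rw [e3pL_eq_of_le h', e3pL_eq_of_le h]
    simp only [Nat.add_sub_cancel]
    obtain ⟨θ', hθ'⟩ : ∃ θ', V - (sA + (sB + dB) + sC) = θ' := ⟨_, rfl⟩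
    have hθ : V - (sA + sB + sC) = θ' + dB := by omega
    rw [hθ', hθ]
    have key := Nat.mul_le_mul_right dB hM
    nlinarith [key, Nat.zero_le (y - 1), Nat.zero_le ((y - 1) * (sA + sC))]
  · rw [e3pL_eq_of_ge (by omega : V ≤ sA + (sB + dB) + sC)]
    by_cases h : sA + sB + sC ≤ V
    · rw [e3pL_eq_of_le h]
      simp only [Nat.add_sub_cancel]
      obtain ⟨θ, hθ⟩ : ∃ θ, V - (sA + sB + sC) = θ := ⟨_, rfl⟩
      have hV : V = θ + sA + sB + sC := by omega
      rw [hθ]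
      have e1 : V - (sB + dB) ≤ sA + sC := by omega
      have e2 : V - sA = θ + (sB + sC) := by omega
      have e3 : V - sC = θ + (sA + sB) := by omega
      rw [e2, e3]
      have key := Nat.mul_le_mul_right θ hM
      nlinarith [e1, key, Nat.zero_le (y - 1), Nat.mul_le_mul_left (y - 1) e1]
    · rw [e3pL_eq_of_ge (by omega : V ≤ sA + sB + sC)]
      have e1 : V - (sB + dB) ≤ V - sB := by omega
      gcongr

/-- `e3pL` is antitone in the slack `sC` (`x, y ≥ 1`, `x + y ≤ M + 1`). [original] -/
theorem e3pL_anti_C {M V x y z sA sB sC sC' : ℕ} (hx : 1 ≤ x) (hy : 1 ≤ y) (hxy : x + y ≤ M + 1) (hC : sC ≤ sC') :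
    e3pL M V x y z sA sB sC' ≤ e3pL M V x y z sA sB sC := by
  obtain ⟨x, rfl⟩ := Nat.exists_eq_add_of_le' hx
  obtain ⟨y, rfl⟩ := Nat.exists_eq_add_of_le' hy
  obtain ⟨dC, rfl⟩ := Nat.exists_eq_add_of_le hC
  have hM : 1 + x + y ≤ M := by omega
  by_cases h' : sA + sB + (sC + dC) ≤ V
  · have h : sA + sB + sC ≤ V := by omega
    rw [e3pL_eq_of_le h', e3pL_eq_of_le h]
    simp only [Nat.add_sub_cancel]
    obtain ⟨θ', hθ'⟩ : ∃ θ', V - (sA + sB + (sC + dC)) = θ' := ⟨_, rfl⟩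
    have hθ : V - (sA + sB + sC) = θ' + dC := by omega
    rw [hθ', hθ]
    have key := Nat.mul_le_mul_right dC hM
    nlinarith [key, Nat.zero_le (z - 1), Nat.zero_le ((z - 1) * (sA + sB))]
  · rw [e3pL_eq_of_ge (by omega : V ≤ sA + sB + (sC + dC))]
    by_cases h : sA + sB + sC ≤ V
    · rw [e3pL_eq_of_le h]
      simp only [Nat.add_sub_cancel]
      obtain ⟨θ, hθ⟩ : ∃ θ, V - (sA + sB + sC) = θ := ⟨_, rfl⟩
      have hV : V = θ + sA + sB + sC := by omega
      rw [hθ]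
      have e1 : V - (sC + dC) ≤ sA + sB := by omega
      have e2 : V - sA = θ + (sB + sC) := by omega
      have e3 : V - sB = θ + (sA + sC) := by omega
      rw [e2, e3]
      have key := Nat.mul_le_mul_right θ hM
      nlinarith [e1, key, Nat.zero_le (z - 1), Nat.mul_le_mul_left (z - 1) e1]
    · rw [e3pL_eq_of_ge (by omega : V ≤ sA + sB + sC)]
      have e1 : V - (sC + dC) ≤ V - sC := by omega
      gcongr

/-- **`e3pL` is antitone in the three slacks jointly** (`x, y, z ≥ 1` and the three pair conditions, all implied by `xyz ≤ M`).
[original] -/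
theorem e3pL_anti {M V x y z sA sB sC sA' sB' sC' : ℕ} (hx : 1 ≤ x) (hy : 1 ≤ y) (hz : 1 ≤ z)
    (hyz : y + z ≤ M + 1) (hxz : x + z ≤ M + 1) (hxy : x + y ≤ M + 1)
    (hA : sA ≤ sA') (hB : sB ≤ sB') (hC : sC ≤ sC') :
    e3pL M V x y z sA' sB' sC' ≤ e3pL M V x y z sA sB sC :=
  (e3pL_anti_C (sA := sA') (sB := sB') hx hy hxy hC).trans
    ((e3pL_anti_B (sA := sA') (sC := sC) hx hz hxz hB).trans (e3pL_anti_A hy hz hyz hA))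

/-- Sizes `≥ 1` with `xyz ≤ M` give the three side conditions of `e3pL_anti`. [bookkeeping] -/
theorem pair_le_of_vol_le {M x y z : ℕ} (hx : 1 ≤ x) (hy : 1 ≤ y) (hz : 1 ≤ z) (hV : x * y * z ≤ M) :
    y + z ≤ M + 1 ∧ x + z ≤ M + 1 ∧ x + y ≤ M + 1 := by
  obtain ⟨x, rfl⟩ := Nat.exists_eq_add_of_le' hx
  obtain ⟨y, rfl⟩ := Nat.exists_eq_add_of_le' hy
  obtain ⟨z, rfl⟩ := Nat.exists_eq_add_of_le' hz
  refine ⟨?_, ?_, ?_⟩ <;> nlinarith [Nat.zero_le (x * y), Nat.zero_le (y * z), Nat.zero_le (x * z), Nat.zero_le (x * y * z)]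

/-- **`e3pLHS` is monotone in the off-member packing sums** (`x, y, z ≥ 1`, `xyz ≤ M`): if `S_A ≤ S_A'`, `S_B ≤ S_B'`, `S_C ≤ S_C'`
then `e3pLHS … S_A S_B S_C ≤ e3pLHS … S_A' S_B' S_C'`.  Adding members to a family raises the off-member sums of every old member,
so an E3⁺ kill is inherited by every super-family. [original] -/
theorem e3pLHS_mono {M x y z SA SB SC SA' SB' SC' : ℕ} (hx : 1 ≤ x) (hy : 1 ≤ y) (hz : 1 ≤ z) (hV : x * y * z ≤ M)
    (hA : SA ≤ SA') (hB : SB ≤ SB') (hC : SC ≤ SC') :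
    e3pLHS M x y z SA SB SC ≤ e3pLHS M x y z SA' SB' SC' := by
  obtain ⟨h1, h2, h3⟩ := pair_le_of_vol_le hx hy hz hV
  unfold e3pLHS
  exact e3pL_anti hx hy hz h1 h2 h3 (by omega) (by omega) (by omega)

/-! ## Heredity of `E3pAdm` along injections (sub-families of admissible families are admissible) -/

/-- An off-member sum of a sub-family indexed along an injection `f` is at most the corresponding off-member sum of the full family.
[bookkeeping] -/
theorem sum_erase_comp_le {N N' : ℕ} (f : Fin N' → Fin N) (hf : Function.Injective f) (w : Fin N → ℕ) (t : Fin N') :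
    ∑ u ∈ univ.erase t, w (f u) ≤ ∑ u ∈ univ.erase (f t), w u := by
  classical
  rw [← sum_image (f := fun u => w u) (s := univ.erase t) (g := f) (fun a _ b _ h => hf h)]
  refine sum_le_sum_of_subset_of_nonneg (fun v hv => ?_) (fun _ _ _ => Nat.zero_le _)
  rw [mem_image] at hv
  obtain ⟨u, hu, rfl⟩ := hv
  rw [mem_erase] at hu ⊢
  exact ⟨fun h => hu.1 (hf h), mem_univ _⟩

/-- **Heredity.**  If a shape list with positive sizes and volumes `≤ M` is `E3pAdm M`, so is every sub-list (re-indexed along an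
injection `f`).  Contrapositive = the certificate form: a prefix killed by E3⁺ at member `t` kills every completion. [original] -/
theorem E3pAdm.restrict {N N' M : ℕ} {a b c : Fin N → ℕ} (h : E3pAdm M a b c) (f : Fin N' → Fin N)
    (hf : Function.Injective f) (hpos : ∀ t, 1 ≤ a t ∧ 1 ≤ b t ∧ 1 ≤ c t) (hV : ∀ t, a t * b t * c t ≤ M) :
    E3pAdm M (a ∘ f) (b ∘ f) (c ∘ f) := by
  intro t h2
  simp only [Function.comp_apply] at h2 ⊢
  refine le_trans (e3pLHS_mono (hpos (f t)).1 (hpos (f t)).2.1 (hpos (f t)).2.2 (hV (f t)) ?_ ?_ ?_) (h (f t) h2)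
  · exact sum_erase_comp_le f hf (fun u => b u * c u) t
  · exact sum_erase_comp_le f hf (fun u => c u * a u) t
  · exact sum_erase_comp_le f hf (fun u => a u * b u) t

end STPPThreeRoomEnergy

end Summit.MatrixMultiplication.MatrixMultiplication.Theorems
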